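import Literature.AlgebraicGeometry.Frobenioids.PadicFrobenioidUnitGroups
import Literature.AnabelianGeometry.EtaleTheta.TemperedFrobenioidCor38SubPreStepsDegree
import HarnessLib

/-!
# [EtTh] Cor. 3.8 proof row C38-L02a `PreservesPreSteps` (F-2809): the base of the image of a pre-step is
# AUT-RIGID — no non-trivial automorphism of its source coequalises it (a hand from Def. 3.6 (ii)(a))

S. Mochizuki, *The étale theta function and its Frobenioid-theoretic manifestations*, Publ. RIMS **45** (2009)
[EtTh], Cor. 3.8, proof, PDF p. 81 l. 2–3 ("by [Mzk17], Theorem 3.4, (ii) … it follows that `Ψ` preserves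
pre-steps") and Def. 3.6 (ii)(a), PDF p. 77 ("the submonoid `Φ^{bs-fld} := (ℝ·Φ₀^cnst)|_D ×_{(Φ^{ℝ-log})^gp} Φ`
… is monoprime") [cite: MochizukiEtTh2009, Cor 3.8 p.81]; S. Mochizuki, *The geometry of Frobenioids I*, Kyushu J.
Math. **62** (2008) [FrdI], §0 p. 10 (monoprime monoids: `≅ ℤ_{≥0}, ℚ_{≥0}, ℝ_{≥0}`, hence sharp), p. 14
(fiberwise-surjective morphisms), Def. 1.2 (iii) p. 22 (pre-steps = linear base-isomorphisms), Thm. 5.2 (i) p. 100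
(model Frobenioids: morphisms `(deg_Fr, Base, Div, u)`) [cite: MochizukiFrdI2008, Thm. 5.2(i) p.100].

abc-iut cell, block C / F (fact-proving wave), seat abc-iut-f-128 (gen 13).  PROOF-ONLY file (0 definitions, 0
instances, 0 notation), a further HAND for the decision on the bare universal closure of
`Cor38Hyp.PreservesPreSteps` (FACT-LIST F-2809; decision of record «undecided-as-typed», desk verdict TRUE, census
#1–#8 of abc-iut-f-032 / w6-d040 / L1-t13 / f-136 / f-109 / f-176 / w6-d057 / w6-d079 / f-151).  Constraints of record on
a would-be separating record: `Ψ` of a pre-step is LINEAR (abc-iut-f-151, `Cor38Hyp.isLinear_map_of_isPreStep`) and its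
`Base` is FIBERWISE-SURJECTIVE (abc-iut-w6-d057, `Cor38Hyp.isFiberwiseSurjective_baseMap_map_of_isPreStep`); with
CANCELLATIVE divisor monoids it is moreover monic (abc-iut-w6-d079).  The census READING left open, in particular, "a
linear morphism over a NON-MONIC fiberwise-surjective arrow" of `D₂` — the arrows of Galois-covering type (`G/H → G/K`,
coequalised by the deck transformations `K/H ⊆ Aut(G/H)`; the quotient `P → *` of the transitive `ℤ/2`-sets).

THIS FILE uses a clause of the typed Def. 3.6 (ii) interface that NO hand of record uses — (a) "`Φ^{bs-fld}` is
monoprime", `TemperedFrobenioid.isMonoprime_bsFld`, hence `Φ^{bs-fld}(A)` is SHARP (`IsMonoprime.isSharp`) — and proves,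
for EVERY equivalence `e : C₁ ⥲ C₂` between the Frobenioids of two typed tempered Frobenioids (arbitrary vocabularies,
arbitrary — possibly non-cancellative — `Φ`, arbitrary `B`) and every pre-step `φ` of `C₁`:

* **`TemperedFrobenioid.eq_id_of_comp_baseMap_map_eq_of_isPreStep`** — `Base(e φ) =: f : A → A'` is AUT-RIGID: every
  AUTOMORPHISM `a` of `A` in `D₂` with `a ≫ f = f` is the identity.  ARGUMENT.  In the model Frobenioid, `e φ = ν ≫ π_f`
  with `π_f := (1, f, 0, 0) : (A, f^*α') → (A', α')` the pure pull-back arrow (`ModelFrobenioid.exists_fac_of_comp_baseMap_eq`),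
  and `Θ_a := (1, a, 0, 0)` is an automorphism of `(A, f^*α')` with `Θ_a ≫ π_f = π_f`.  Transport by `e⁻¹`: `ρ := e⁻¹ π_f`
  is a PRE-STEP (a right factor of the pre-step `e⁻¹ e φ`; abc-iut-w6-d040's `opsData_isPreStep_of_comp_right`) and
  `θ := e⁻¹ Θ_a` an automorphism with `θ ≫ ρ = ρ`; reading `(deg_Fr, Base, Div, u)`: `deg θ = 1`, `Base θ = id`
  (`Base ρ` is invertible), `u_θ = 0`, and `Div ρ · Div θ = Div ρ` in `Φ₁(W) ⊆ Φ^{ℝ-log}(W)` — so the class of the UNIT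
  `Div θ` in `(Φ^{ℝ-log})^gp(W)` is trivial, i.e. lies in `ℝ·Φ₀^cnst`: `Div θ ∈ Φ^{bs-fld}(W)`, a unit of a SHARP monoid
  (`TemperedFrobenioid.eq_one_of_isUnit_of_isBaseFieldTheoreticDiv`), whence `Div θ = 0`, `θ = id`, `Θ_a = id`, `a = id`.
* `Cor38Hyp.eq_id_of_comp_baseMap_map_eq_of_isPreStep` (+ the `Ψ⁻¹` mirror) for every record `h : Cor38Hyp C₁ C₂`.
* CLOSERS of the row with NO hypothesis on `Φ`, `B`, degrees or partners:
  **`Cor38Hyp.preservesPreSteps_of_isIso_of_autRigid`** — if in `D₁`, `D₂` every fiberwise-surjective arrow with trivial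
  automorphism-stabiliser is invertible (⊋ the class "fiberwise-surjective ⇒ invertible" of abc-iut-w6-d057 / f-151), and
  **`Cor38Hyp.preservesPreSteps_of_exists_aut_comp_eq`** — if in `D₁`, `D₂` every NON-invertible arrow `f : A → A'` is
  coequalised by a non-trivial automorphism of `A` (`a ≫ f = f`, `a ≠ id`): towers of Galois coverings, the connected
  `G`-sets / coset categories of an ABELIAN (or Dedekind) group `G` (`G/H → G/K` is fixed by `K/H`), the transitive
  `ℤ/2`-sets `{P ⟲ ℤ/2 → *}`.

READING (cell rule R5; the FACT-LIST label of F-2809 is NOT moved by this file: conditional / instance PROVED / bare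
closure open-as-typed).  The door "linear image over a non-monic fiberwise-surjective base arrow" SHRINKS to AUT-RIGID
such arrows (e.g. `S₃/⟨(12)⟩ → *`, whose non-injectivity is witnessed by non-invertible arrows out of `S₃/1` only); every
Galois-quotient-type arrow is excluded for ALL typed data, cancellative or not; and over bases all of whose non-invertible
arrows carry deck transformations the row HOLDS for every record.  No [FrdI] Thm. 3.4 input; the only interface clauses
used are Def. 3.6 (i) "`B₀^Λ` group-like", Def. 3.6 (ii) "`D` totally epimorphic" (through the cited hands) and (ii)(a).
HONEST FRAMING: bookkeeping about OUR typed Def. 3.6 interface (print's Cor. 3.8 quotes [FrdI] Thm. 3.4 (ii) for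
genuine Frobenioids); proved-as-typed ≠ proved-in-print; nothing here bears on [IUTchIII] Cor. 3.12; no side taken; a
FACT row is an assumption label; typed ≠ proved.
-/

namespace Literature.AlgebraicGeometry.Frobenioids

open CategoryTheory Opposite

universe w v u

/-! ## §1 Model Frobenioids: the pull-back factorisation of a morphism and the stabiliser automorphisms of its base -/

namespace ModelFrobenioid

variable {D : Type u} [Category.{v} D] {Φ B : Dᵒᵖ ⥤ CommMonCat.{w}} {DivB : B ⟶ monoidGp Φ}

/-- **Pull-back factorisation and base stabilisers.**  In the model Frobenioid of ANY data `(D, Φ, B, B → Φ^gp)`,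
a morphism `κ = (d, f, Z, u) : (A, α) → (A', α')` factors as `κ = ν ≫ π_f` through the object `(A, f^*α')`, with
`ν = (d, id, Z, u)` and `π_f = (1, f, 0, 0)` the pure pull-back arrow; and every `a : A → A` with `a ≫ f = f` gives the
endomorphism `Θ_a = (1, a, 0, 0)` of `(A, f^*α')` with `Θ_a ≫ π_f = π_f` — distinct from the identity as soon as `a` is.
[cite: MochizukiFrdI2008, Thm. 5.2(i) p.100] -/
theorem exists_fac_of_comp_baseMap_eq {X Y : ModelFrobenioid Φ B DivB} (κ : X ⟶ Y) (a : X.base ⟶ X.base)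
    (ha : a ≫ baseMap κ = baseMap κ) :
    ∃ (c : Algebra.GrothendieckGroup (Φ.obj (op X.base)))
      (ν : X ⟶ (⟨X.base, c⟩ : ModelFrobenioid Φ B DivB))
      (π : (⟨X.base, c⟩ : ModelFrobenioid Φ B DivB) ⟶ Y)
      (Θ : (⟨X.base, c⟩ : ModelFrobenioid Φ B DivB) ⟶ ⟨X.base, c⟩),
      ν ≫ π = κ ∧ Θ ≫ π = π ∧ degFr π = 1 ∧ degFr Θ = 1 ∧ baseMap Θ = a ∧
        div Θ = 1 ∧ (Θ = 𝟙 _ → a = 𝟙 _) := by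
  refine ⟨pullGp Φ (baseMap κ) Y.cls, mkHom X _ (degFr κ) (𝟙 X.base) (div κ) (unit κ) ?_,
    mkHom _ Y 1 (baseMap (X := X) (Y := Y) κ) 1 1 ?_, mkHom _ _ 1 a 1 1 ?_, ?_, ?_, rfl, rfl, rfl, rfl, ?_⟩
  · -- relation of `ν = (d, id, Z, u)`: that of `κ`, read over the identity
    change X.cls ^ (degFr κ : ℕ) * Algebra.GrothendieckGroup.of (div κ) =
      pullGp Φ (𝟙 X.base) (pullGp Φ (baseMap κ) Y.cls) * divB Φ B DivB (op X.base) (unit κ)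
    rw [pullGp_id]
    exact rel κ
  · -- relation of `π_f = (1, f, 0, 0)`
    change (pullGp Φ (baseMap κ) Y.cls) ^ ((1 : ℕ+) : ℕ) * Algebra.GrothendieckGroup.of 1 =
      pullGp Φ (baseMap κ) Y.cls * divB Φ B DivB (op X.base) 1
    rw [PNat.one_coe, pow_one, map_one, map_one]
  · -- relation of `Θ_a = (1, a, 0, 0)`: `a^* f^* α' = (a ≫ f)^* α' = f^* α'`
    change (pullGp Φ (baseMap κ) Y.cls) ^ ((1 : ℕ+) : ℕ) * Algebra.GrothendieckGroup.of 1 =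
      pullGp Φ a (pullGp Φ (baseMap κ) Y.cls) * divB Φ B DivB (op X.base) 1
    rw [PNat.one_coe, pow_one, map_one, map_one, mul_one, mul_one, ← pullGp_comp, ha]
  · -- `ν ≫ π_f = κ`
    refine hom_ext ?_ ?_ ?_ ?_
    · change 1 * degFr κ = degFr κ
      rw [one_mul]
    · change 𝟙 X.base ≫ baseMap κ = baseMap κ
      rw [Category.id_comp]
    · change (Φ.map (𝟙 X.base).op).hom 1 * div κ ^ ((1 : ℕ+) : ℕ) = div κ
      rw [map_one, one_mul, PNat.one_coe, pow_one]
    · change (B.map (𝟙 X.base).op).hom 1 * unit κ ^ ((1 : ℕ+) : ℕ) = unit κ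
      rw [map_one, one_mul, PNat.one_coe, pow_one]
  · -- `Θ_a ≫ π_f = π_f`
    refine hom_ext ?_ ha ?_ ?_
    · change (1 : ℕ+) * 1 = 1
      rw [mul_one]
    · change (Φ.map a.op).hom 1 * (1 : (Φ.obj (op X.base) : Type w)) ^ ((1 : ℕ+) : ℕ) = 1
      rw [map_one, one_pow, mul_one]
    · change (B.map a.op).hom 1 * (1 : (B.obj (op X.base) : Type w)) ^ ((1 : ℕ+) : ℕ) = 1
      rw [map_one, one_pow, mul_one]
  · -- `Θ_a = id ⇒ a = id`
    intro hΘ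
    exact congrArg Hom.base hΘ

end ModelFrobenioid

end Literature.AlgebraicGeometry.Frobenioids

/-! ## §2 The typed Def. 3.6 interface: units of `Φ(A)` inside `Φ^{bs-fld}(A)` are trivial; the aut-rigidity theorem -/

namespace Literature.AnabelianGeometry.EtaleTheta

open CategoryTheory Opposite Literature.AlgebraicGeometry.Frobenioids

universe u₀ v₀ u v w

variable {D₀ : Type u₀} [Category.{v₀} D₀] {V : FrdIMonoidStub.{w}}
  {T : RealifiedDivisorMonoids (D₀ := D₀) V} {D : Type u} [Category.{v} D] {VD : FrdICatStub.{u, v, w} D}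

namespace TemperedFrobenioid

variable (C : TemperedFrobenioid T D VD)

/-- **Def. 3.6 (ii)(a) ⇒ no units of `Φ(A)` in `Φ^{bs-fld}(A)` but `1`.**  A unit `x` of `Φ(A)` whose class in
`(Φ^{ℝ-log})^gp(A)` lies in `ℝ·Φ₀^cnst` — i.e. `x ∈ Φ^{bs-fld}(A)` — is trivial: its inverse lies in `Φ^{bs-fld}(A)` too
(`ℝ·Φ₀^cnst` is a subgroup), so `x` is a unit of the MONOPRIME, hence sharp ([FrdI] §0 p. 10), monoid `Φ^{bs-fld}(A)`.
[cite: MochizukiEtTh2009, Def 3.6 p.77] -/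
theorem eq_one_of_isUnit_of_isBaseFieldTheoreticDiv {A : D} (x : C.divisorMonoid.obj (op A)) (hx : IsUnit x)
    (hbs : C.IsBaseFieldTheoreticDiv x) : x = 1 := by
  obtain ⟨ux, rfl⟩ := hx
  -- the inverse, and the product read in `Φ^{ℝ-log}(A)`
  have hval : Subtype.val (ux : C.divisorMonoid.obj (op A)) *
      Subtype.val ((ux⁻¹ : (C.divisorMonoid.obj (op A))ˣ) : C.divisorMonoid.obj (op A)) = 1 :=
    congrArg Subtype.val ux.mul_inv
  -- the inverse also lies in `Φ^{bs-fld}(A)`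
  have hinv : C.IsBaseFieldTheoreticDiv ((ux⁻¹ : (C.divisorMonoid.obj (op A))ˣ) : C.divisorMonoid.obj (op A)) := by
    refine ⟨((ux⁻¹ : (C.divisorMonoid.obj (op A))ˣ) : C.divisorMonoid.obj (op A)).2, ?_⟩
    change Algebra.GrothendieckGroup.of
        (Subtype.val ((ux⁻¹ : (C.divisorMonoid.obj (op A))ˣ) : C.divisorMonoid.obj (op A))) ∈ T.cnstR (C.baseOp (op A))
    rw [eq_inv_of_mul_eq_one_right (by rw [← map_mul, hval, map_one] :
      Algebra.GrothendieckGroup.of (Subtype.val (ux : C.divisorMonoid.obj (op A))) *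
        Algebra.GrothendieckGroup.of
          (Subtype.val ((ux⁻¹ : (C.divisorMonoid.obj (op A))ˣ) : C.divisorMonoid.obj (op A))) = 1)]
    exact (T.cnstR (C.baseOp (op A))).inv_mem hbs.2
  -- so `ux` is a unit of the SHARP monoid `Φ^{bs-fld}(A)` ([FrdI] §0: monoprime ⇒ sharp)
  have hsharp := (C.isMonoprime_bsFld (op A)).isSharp
  have h1 : (⟨Subtype.val (ux : C.divisorMonoid.obj (op A)), hbs⟩ :
      ↥(C.Φ.carrier (op A) ⊓ (T.cnstR (op (C.base.obj A))).toSubmonoid.comap Algebra.GrothendieckGroup.of)) = 1 :=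
    hsharp.eq_one_of_isUnit _ (IsUnit.of_mul_eq_one
      ⟨Subtype.val ((ux⁻¹ : (C.divisorMonoid.obj (op A))ˣ) : C.divisorMonoid.obj (op A)), hinv⟩ (Subtype.ext hval))
  have h2 := congrArg Subtype.val h1
  have h3 : Subtype.val (ux : C.divisorMonoid.obj (op A)) = 1 := h2
  exact Subtype.ext h3

/-- In the Frobenioid of a typed tempered Frobenioid, an AUTOMORPHISM `θ` of an object that is absorbed on the divisor
side by some morphism `ρ` out of that object — `Div ρ · Div θ = Div ρ` in `Φ(A)` — has trivial zero divisor: the class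
of the unit `Div θ` in `(Φ^{ℝ-log})^gp(A)` is trivial, so `Div θ ∈ Φ^{bs-fld}(A)` and Def. 3.6 (ii)(a) applies.
[cite: MochizukiEtTh2009, Def 3.6 p.77] -/
theorem div_eq_one_of_isIso_of_mul_div_eq {P Q : C.category} (θ : P ⟶ P) [IsIso θ] (ρ : P ⟶ Q)
    (h : ModelFrobenioid.div ρ * ModelFrobenioid.div θ = ModelFrobenioid.div ρ) : ModelFrobenioid.div θ = 1 := by
  have hU : IsUnit (ModelFrobenioid.div θ) := ElemFrobenioid.isUnit_div_of_isIso (C.toElem.map θ)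
  refine C.eq_one_of_isUnit_of_isBaseFieldTheoreticDiv (ModelFrobenioid.div θ) hU ⟨(ModelFrobenioid.div θ).2, ?_⟩
  change Algebra.GrothendieckGroup.of (Subtype.val (ModelFrobenioid.div θ)) ∈ T.cnstR (C.baseOp (op P.base))
  have h1 := congrArg Subtype.val h
  have h2 : Subtype.val (ModelFrobenioid.div ρ) * Subtype.val (ModelFrobenioid.div θ) =
      Subtype.val (ModelFrobenioid.div ρ) := h1
  have h3 := congrArg Algebra.GrothendieckGroup.of h2
  rw [map_mul, mul_eq_left] at h3
  rw [h3]
  exact (T.cnstR (C.baseOp (op P.base))).one_mem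

end TemperedFrobenioid

section Rows

variable {D₀' : Type u₀} [Category.{v₀} D₀'] {T' : RealifiedDivisorMonoids (D₀ := D₀') V}
  {D' : Type u} [Category.{v} D'] {VD' : FrdICatStub.{u, v, w} D'}
  {C₁ : TemperedFrobenioid T D VD} {C₂ : TemperedFrobenioid T' D' VD'}

namespace TemperedFrobenioid

/-- **The base of the image of a pre-step is AUT-RIGID** (every typed datum, every equivalence).  For any equivalence
`e : C₁ ⥲ C₂` of the Frobenioids of two typed tempered Frobenioids and any pre-step `φ : X → Y` of `C₁`, every
automorphism `a` of `Base(e X)` in `D₂` with `a ≫ Base(e φ) = Base(e φ)` is the identity.  (The stabiliser automorphism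
`Θ_a = (1, a, 0, 0)` of the pull-back factor `π_f` of `e φ` goes under `e⁻¹` to a base-identity automorphism `θ` of unit
zero divisor with `Div ρ · Div θ = Div ρ`, `ρ := e⁻¹ π_f` a pre-step; so `Div θ` is a unit of the sharp `Φ^{bs-fld}`,
`θ = id`, `a = id`.) [cite: MochizukiEtTh2009, Cor 3.8 p.81] -/
theorem eq_id_of_comp_baseMap_map_eq_of_isPreStep (e : C₁.category ≌ C₂.category) {X Y : C₁.category}
    (φ : X ⟶ Y) (hφ : C₁.opsData.IsPreStep φ) (a : (e.functor.obj X).base ≅ (e.functor.obj X).base)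
    (ha : a.hom ≫ ModelFrobenioid.baseMap (e.functor.map φ) = ModelFrobenioid.baseMap (e.functor.map φ)) :
    a.hom = 𝟙 _ := by
  have hB₁ : ∀ (A : Dᵒᵖ) (b : (C₁.ratFnFunctor.obj A : Type w)), IsUnit b :=
    fun _ b => C₁.isUnit_ratFn (T.isUnit_BΛ _) b
  have hB₂ : ∀ (A : D'ᵒᵖ) (b : (C₂.ratFnFunctor.obj A : Type w)), IsUnit b :=
    fun _ b => C₂.isUnit_ratFn (T'.isUnit_BΛ _) b
  -- the pull-back factorisation `e φ = ν ≫ π_f` and the stabiliser `Θ_a` in `C₂`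
  obtain ⟨c, ν, π, Θ, hνπ, hΘπ, -, hΘd, hΘb, hΘdiv, hΘid⟩ :=
    ModelFrobenioid.exists_fac_of_comp_baseMap_eq (e.functor.map φ) a.hom ha
  apply hΘid
  haveI : IsIso (ModelFrobenioid.baseMap Θ) := by rw [hΘb]; infer_instance
  haveI : IsIso Θ := ModelFrobenioid.isIso_of (ModelFrobenioid.isGroupLike_of_isUnit hB₂) Θ hΘdiv hΘd
  -- transport by `e⁻¹`: `ρ := e⁻¹ π_f` is a pre-step, `θ := e⁻¹ Θ_a` an automorphism with `θ ≫ ρ = ρ`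
  have hρ : C₁.opsData.IsPreStep (e.inverse.map π) := by
    refine C₁.opsData_isPreStep_of_comp_right (e.inverse.map ν) (e.inverse.map π) ?_
    rw [← e.inverse.map_comp, hνπ]
    exact isPreStep_inverse_map_functor_map e φ hφ
  obtain ⟨hρd, hρb⟩ := (C₁.opsData_isPreStep_iff _).1 hρ
  have hθρ : e.inverse.map Θ ≫ e.inverse.map π = e.inverse.map π := by rw [← e.inverse.map_comp, hΘπ]
  -- `Base θ = id`
  have hθb : ModelFrobenioid.baseMap (e.inverse.map Θ) = 𝟙 _ := by
    haveI := hρb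
    have h := congrArg ModelFrobenioid.baseMap hθρ
    rw [ModelFrobenioid.baseMap_comp] at h
    rw [← cancel_mono (ModelFrobenioid.baseMap (e.inverse.map π)), h, Category.id_comp]
  -- `deg θ = 1`
  have hθd : ModelFrobenioid.degFr (e.inverse.map Θ) = 1 := ModelFrobenioid.degFr_eq_one_of_isIso _
  -- `Div ρ · Div θ = Div ρ`, whence `Div θ = 0` by Def. 3.6 (ii)(a)
  have hdiv : ModelFrobenioid.div (e.inverse.map π) * ModelFrobenioid.div (e.inverse.map Θ) =
      ModelFrobenioid.div (e.inverse.map π) := by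
    have h := congrArg ModelFrobenioid.div hθρ
    rw [ModelFrobenioid.div_comp, hθb, hρd, PNat.one_coe, pow_one, op_id, C₁.divisorMonoid.map_id] at h
    exact h
  have hθdiv : ModelFrobenioid.div (e.inverse.map Θ) = 1 :=
    C₁.div_eq_one_of_isIso_of_mul_div_eq (e.inverse.map Θ) (e.inverse.map π) hdiv
  -- `u_θ = 0`
  have hunit : ModelFrobenioid.unit (e.inverse.map Θ) = 1 := by
    have h := congrArg ModelFrobenioid.unit hθρ
    rw [ModelFrobenioid.unit_comp, hθb, hρd, PNat.one_coe, pow_one, op_id, C₁.ratFnFunctor.map_id] at h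
    exact (hB₁ _ _).mul_left_cancel (h.trans (mul_one _).symm)
  -- hence `θ = id` and `Θ_a = id`
  have hθ : e.inverse.map Θ = 𝟙 _ :=
    ModelFrobenioid.hom_ext (by rw [hθd, ModelFrobenioid.degFr_id]) (by rw [hθb, ModelFrobenioid.baseMap_id])
      (by rw [hθdiv, ModelFrobenioid.div_id]) (by rw [hunit, ModelFrobenioid.unit_id])
  exact e.inverse.map_injective (by rw [hθ, e.inverse.map_id])

/-- The mirror statement for `e⁻¹`: `Base(e⁻¹ φ)` is aut-rigid for every pre-step `φ` of `C₂`.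
[cite: MochizukiEtTh2009, Cor 3.8 p.81] -/
theorem eq_id_of_comp_baseMap_inverse_map_eq_of_isPreStep (e : C₁.category ≌ C₂.category) {X Y : C₂.category}
    (φ : X ⟶ Y) (hφ : C₂.opsData.IsPreStep φ) (a : (e.inverse.obj X).base ≅ (e.inverse.obj X).base)
    (ha : a.hom ≫ ModelFrobenioid.baseMap (e.inverse.map φ) = ModelFrobenioid.baseMap (e.inverse.map φ)) :
    a.hom = 𝟙 _ :=
  eq_id_of_comp_baseMap_map_eq_of_isPreStep e.symm φ hφ a ha

end TemperedFrobenioid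

namespace Cor38Hyp

variable (h : Cor38Hyp C₁ C₂)

/-- **Row C38-L02a / F-2809, for EVERY record: `Base(Ψ φ)` of a pre-step `φ` of `C₁` is aut-rigid** — an automorphism
`a` of its source with `a ≫ Base(Ψ φ) = Base(Ψ φ)` is the identity. [cite: MochizukiEtTh2009, Cor 3.8 p.81] -/
theorem eq_id_of_comp_baseMap_map_eq_of_isPreStep {X Y : C₁.category} (φ : X ⟶ Y) (hφ : C₁.opsData.IsPreStep φ)
    (a : (h.Ψ.functor.obj X).base ≅ (h.Ψ.functor.obj X).base)
    (ha : a.hom ≫ ModelFrobenioid.baseMap (h.Ψ.functor.map φ) = ModelFrobenioid.baseMap (h.Ψ.functor.map φ)) :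
    a.hom = 𝟙 _ :=
  TemperedFrobenioid.eq_id_of_comp_baseMap_map_eq_of_isPreStep h.Ψ φ hφ a ha

/-- The mirror for `Ψ⁻¹`: `Base(Ψ⁻¹ φ)` of a pre-step `φ` of `C₂` is aut-rigid. [cite: MochizukiEtTh2009, Cor 3.8 p.81] -/
theorem eq_id_of_comp_baseMap_inverse_map_eq_of_isPreStep {X Y : C₂.category} (φ : X ⟶ Y)
    (hφ : C₂.opsData.IsPreStep φ) (a : (h.Ψ.inverse.obj X).base ≅ (h.Ψ.inverse.obj X).base)
    (ha : a.hom ≫ ModelFrobenioid.baseMap (h.Ψ.inverse.map φ) = ModelFrobenioid.baseMap (h.Ψ.inverse.map φ)) :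
    a.hom = 𝟙 _ :=
  TemperedFrobenioid.eq_id_of_comp_baseMap_inverse_map_eq_of_isPreStep h.Ψ φ hφ a ha

/-- **Closer of row C38-L02a (F-2809) with NO hypothesis on `Φ`, `B`, degrees or partners**: if in `D₁` and `D₂` every
fiberwise-surjective arrow `f : A → A'` whose automorphism-stabiliser `{a ∈ Aut(A) | a ≫ f = f}` is trivial is an
isomorphism, then `Ψ` and `Ψ⁻¹` preserve pre-steps (`Ψ φ` is linear by abc-iut-f-151, its base fiberwise-surjective by
abc-iut-w6-d057 and aut-rigid by this file). [cite: MochizukiEtTh2009, Cor 3.8 p.81] -/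
theorem preservesPreSteps_of_isIso_of_autRigid
    (hD : ∀ ⦃A A' : D⦄ (f : A ⟶ A'), IsFiberwiseSurjective f →
      (∀ a : A ≅ A, a.hom ≫ f = f → a.hom = 𝟙 A) → IsIso f)
    (hD' : ∀ ⦃A A' : D'⦄ (f : A ⟶ A'), IsFiberwiseSurjective f →
      (∀ a : A ≅ A, a.hom ≫ f = f → a.hom = 𝟙 A) → IsIso f) :
    h.PreservesPreSteps := by
  refine ⟨fun X Y φ hφ => (C₂.opsData_isPreStep_iff _).2 ⟨h.isLinear_map_of_isPreStep φ hφ, ?_⟩,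
    fun X Y φ hφ => (C₁.opsData_isPreStep_iff _).2 ⟨h.isLinear_inverse_map_of_isPreStep φ hφ, ?_⟩⟩
  · exact hD' _ (h.isFiberwiseSurjective_baseMap_map_of_isPreStep φ hφ)
      (fun a ha => h.eq_id_of_comp_baseMap_map_eq_of_isPreStep φ hφ a ha)
  · exact hD _ (h.isFiberwiseSurjective_baseMap_inverse_map_of_isPreStep φ hφ)
      (fun a ha => h.eq_id_of_comp_baseMap_inverse_map_eq_of_isPreStep φ hφ a ha)

/-- **Closer of row C38-L02a (F-2809) over bases all of whose non-invertible arrows carry deck transformations**: if in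
`D₁` and `D₂` every NON-invertible arrow `f : A → A'` is coequalised by a non-trivial automorphism of `A` (`a ≫ f = f`,
`a ≠ id`) — towers of Galois coverings; the connected `G`-sets / coset categories of an abelian (or Dedekind) group `G`,
where `G/H → G/K` is fixed by `K/H ⊆ Aut(G/H)`; the transitive `ℤ/2`-sets `{P ⟲ ℤ/2 → *}` —, then `Ψ` and `Ψ⁻¹` preserve
pre-steps, for EVERY record over such bases. [cite: MochizukiEtTh2009, Cor 3.8 p.81] -/
theorem preservesPreSteps_of_exists_aut_comp_eq
    (hD : ∀ ⦃A A' : D⦄ (f : A ⟶ A'), ¬ IsIso f → ∃ a : A ≅ A, a.hom ≠ 𝟙 A ∧ a.hom ≫ f = f)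
    (hD' : ∀ ⦃A A' : D'⦄ (f : A ⟶ A'), ¬ IsIso f → ∃ a : A ≅ A, a.hom ≠ 𝟙 A ∧ a.hom ≫ f = f) :
    h.PreservesPreSteps := by
  refine h.preservesPreSteps_of_isIso_of_autRigid (fun A A' f _ hrig => ?_) (fun A A' f _ hrig => ?_)
  · by_contra hf
    obtain ⟨a, hne, haf⟩ := hD f hf
    exact hne (hrig a haf)
  · by_contra hf
    obtain ⟨a, hne, haf⟩ := hD' f hf
    exact hne (hrig a haf)

end Cor38Hyp

end Rows

end Literature.AnabelianGeometry.EtaleTheta
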